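import Mathlib
import Literature.ModelTheory.ExponentialFields.DefinabilityParams
import Summits.Schanuel.Schanuel.Theorems.RigidCoreMinimalCounterexampleInAclHitSetArithmeticalRingDef
import Summits.Schanuel.Schanuel.Theorems.RigidCoreMinimalCounterexampleInAclHitSetArithmeticalGraphs
import Summits.Schanuel.Schanuel.Theorems.RigidCoreMinimalCounterexampleInAclHitSetArithmeticalRepresentability

/-!
# Computable subsets of `ℤ^k` are `∅`-definable in the ring `ℤ`; the arithmetical hierarchy over `ℤ^k`
# (crux stmt-Schanuel-0969 `RigidCore.MinimalCounterexampleInAcl`, line kernel-arithmetic-selection, stub S8)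

`--supports stmt-Schanuel-0969`; top layer of the representability package under the registered stub
`stub_corankOne_hitSetArithmetical` (S8).  From `ringDefinable_graph_of_partrec` (…HitSetArithmeticalRepresentability.lean):

* `ringDefinable_setOf_computablePred` / registered `ringDefinable_of_computablePred_std` — **every subset `S ⊆ ℤ^k` with
  `ComputablePred (· ∈ S)` (Mathlib: a total recursive characteristic function, inputs coded by Mathlib's `Primcodable`
  structure on `Fin k → ℤ`) is `∅`-definable in `(ℤ, +, ·, −, 0, 1)`**.  The coding `v ↦ encode v` of `ℤ^k` is itself a
  ring-definable function (`ringDefinableFun_encodeFinArrow`: zig-zag coding of `ℤ`, Cantor pairing, list recursion), so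
  `v ∈ S ↔ (encode v, 1) ∈ Γ[χ_S]` is a definable condition;
* unary forms over `ℕ`: `ringDefinable_setOf_computablePred_nat`, `ringDefinable_graph_of_computable`;
* the ARITHMETICAL HIERARCHY: since ring-definable conditions are closed under `∃ z : ℤ`, `∀ z : ℤ`, `∃ n : ℕ`, `∀ n : ℕ`
  (`definable_setOf_exists/forall_params`, `ringDefinable_setOf_existsNat/forallNat`) and under substitution of definable
  functions (`ringDefinable_setOf_substitute`), every `Σ⁰ₙ/Π⁰ₙ` subset of `ℤ^k` — a computable relation prefixed by number
  quantifiers — is `∅`-definable in the ring `ℤ` (packaged `Σ⁰₃/Π⁰₃/Σ⁰₄` forms and the reduction of S8 are in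
  `…HitSetArithmeticalReduction.lean`); combined with `stub_arithmeticTransfer` (…ArithmeticTransfer.lean) it is `∅`-definable
  in `ℂ_exp`.

WHAT REMAINS FOR S8 (status, not proved here): the hit pattern `H_x ⊆ ℤ^m` of a corank-one first failure `x = (u, w)` must be
shown to be such a `Σ⁰₃` set, i.e. `H_x = {κ | ∃ a ∀ b ∃ c, R(κ, a, b, c)}` with `R` computable — computable complex analysis of
`u_k = log α_k` (fixed branch), of the roots `w'` of `P(u + 2πiκ, ·)`, of `exp w'`, exact zero tests as `Π⁰₁` and ℚ-linear
independence as `Π⁰₂` statements (Weihrauch, *Computable Analysis* (2000), §4.3 and §6.3).  No Lean definition of computable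
real/complex numbers exists in Mathlib or this tree yet; that layer is the open remainder of S8.

References: K. Gödel (1931), Satz VII; S. C. Kleene, *Introduction to Metamathematics* (1952), § 57; H. Rogers, *Theory of
Recursive Functions and Effective Computability* (1967), §14.1 (arithmetical hierarchy = definability in `(ℕ, +, ·)`).
-/

-- the summit namespace `Summit.Schanuel.Schanuel.…` repeats a component by design (D-0022)
set_option linter.dupNamespace false

open Set FirstOrder FirstOrder.Language Encodable

namespace Summit.Schanuel.Schanuel.Cruxes.MinimalCounterexampleInAcl.KernelArithmeticSelection

open Literature.ModelTheory.ExponentialFields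

/-! ## A binary function with definable graph, at definable arguments -/

section General

variable {L : Language} {M : Type*} [L.Structure M] {A : Set M} {α : Type*}

/-- A binary function with definable graph applied to two definable functions of tuples is a definable function of tuples
(compositions of definable maps are definable, van den Dries 1998 Ch. 1 (2.3)(iii)). [folklore] -/
theorem definableFun_apply₂_params {h : M → M → M} (hG : A.Definable L {u : Fin 3 → M | u 2 = h (u 0) (u 1)})
    {f g : (α → M) → M} (hf : A.DefinableFun L f) (hg : A.DefinableFun L g) :
    A.DefinableFun L (fun v => h (f v) (g v)) := by
  have h' := hG.preimage_map (definableMap_vecCons (definableFun_reindex hf some)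
    (definableMap_vecCons (definableFun_reindex hg some)
      (definableMap_vecCons (definableFun_proj_params none) definableMap_vecEmpty)))
  unfold Set.DefinableFun Function.tupleGraph
  convert h' using 1
  ext w
  simp only [mem_setOf_eq, mem_preimage, Matrix.cons_val_zero, Matrix.cons_val_one, Matrix.cons_val]
  exact eq_comm

end General

/-! ## Mathlib's codings of `ℤ` and `ℤ^k` -/

section Codes

/-- Mathlib's coding of `ℤ` (through `Primcodable ℤ`, i.e. `Equiv.intEquivNat`: `n ↦ 2n`, `−(n+1) ↦ 2n+1`) as a closed
formula. [folklore] -/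
theorem natCast_encode_int (z : ℤ) :
    ((@encode ℤ Primcodable.toEncodable z : ℕ) : ℤ) = if 0 ≤ z then 2 * z else -2 * z - 1 := by
  show ((Equiv.intEquivNat z : ℕ) : ℤ) = _
  cases z with
  | ofNat n =>
    rw [show Equiv.intEquivNat (Int.ofNat n) = 2 * n from rfl, Int.ofNat_eq_natCast]
    split_ifs with h
    · push_cast; ring
    · omega
  | negSucc n =>
    rw [show Equiv.intEquivNat (Int.negSucc n) = 2 * n + 1 from rfl, if_neg (by simp), Int.negSucc_eq]
    push_cast; ring

/-- Mathlib's coding of `ℤ^k = (Fin k → ℤ)` (through `Primcodable (Fin k → ℤ)`) is the list coding of `(v 0, …, v (k-1))`.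
[folklore] -/
theorem encode_finArrow_int {k : ℕ} (v : Fin k → ℤ) :
    @encode (Fin k → ℤ) Primcodable.toEncodable v = @encode (List ℤ) (@List.encodable ℤ Primcodable.toEncodable) (List.ofFn v) := by
  show encode (List.Vector.ofFn v).toList = _
  rw [List.Vector.toList_ofFn]

end Codes

section RingZ

variable [FirstOrder.Ring.CompatibleRing ℤ] {α : Type*}

/-! ## `Int.toNat`, total pairing and the coding of `ℤ` and of `ℤ^k` are ring-definable functions -/

/-- The graph of `Int.toNat` (as a `ℤ`-valued function) is ring-definable. [folklore] -/
theorem ringDefinable_toNatGraph : (∅ : Set ℤ).Definable Language.ring {v : Fin 2 → ℤ | v 1 = ((v 0).toNat : ℤ)} := by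
  have h : (∅ : Set ℤ).Definable Language.ring
      {v : Fin 2 → ℤ | (0 ≤ v 0 ∧ v 1 = v 0) ∨ (v 0 < 0 ∧ v 1 = 0)} :=
    definable_setOf_or_params
      (definable_setOf_and_params (ringDefinable_setOf_nonneg (definableFun_proj_params _))
        (definable_setOf_eq_params (definableFun_proj_params _) (definableFun_proj_params _)))
      (definable_setOf_and_params (ringDefinable_setOf_lt (definableFun_proj_params _) ringDefinableFun_zero)
        (definable_setOf_eq_params (definableFun_proj_params _) ringDefinableFun_zero))
  convert h using 1
  ext v; simp only [mem_setOf_eq]; omega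

/-- `v ↦ (f v).toNat` is a ring-definable function for ring-definable `f`. [folklore] -/
theorem ringDefinableFun_toNat {f : (α → ℤ) → ℤ} (hf : (∅ : Set ℤ).DefinableFun Language.ring f) :
    (∅ : Set ℤ).DefinableFun Language.ring (fun v => ((f v).toNat : ℤ)) :=
  definableFun_apply_params (f := fun z : ℤ => ((z.toNat : ℕ) : ℤ)) ringDefinable_toNatGraph hf

/-- The total pairing `(x, y) ↦ Nat.pair x.toNat y.toNat` of definable functions is a definable function. [folklore] -/
theorem ringDefinableFun_natPair {f g : (α → ℤ) → ℤ} (hf : (∅ : Set ℤ).DefinableFun Language.ring f)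
    (hg : (∅ : Set ℤ).DefinableFun Language.ring g) :
    (∅ : Set ℤ).DefinableFun Language.ring (fun v => (Nat.pair (f v).toNat (g v).toNat : ℤ)) := by
  refine definableFun_apply₂_params (h := fun x y : ℤ => (Nat.pair x.toNat y.toNat : ℤ)) ?_ hf hg
  have h : (∅ : Set ℤ).Definable Language.ring {u : Fin 3 → ℤ | ∃ w : Fin 2 → ℤ,
      w 0 = ((u 0).toNat : ℤ) ∧ w 1 = ((u 1).toNat : ℤ) ∧ ![w 0, w 1, u 2] ∈ {t : Fin 3 → ℤ | 0 ≤ t 0 ∧ 0 ≤ t 1 ∧ t 2 = (Nat.pair (t 0).toNat (t 1).toNat : ℤ)}} :=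
    definable_setOf_existsBlock (definable_setOf_and_params
      (definable_setOf_eq_params (definableFun_proj_params _) (ringDefinableFun_toNat (definableFun_proj_params _)))
      (definable_setOf_and_params
      (definable_setOf_eq_params (definableFun_proj_params _) (ringDefinableFun_toNat (definableFun_proj_params _)))
      (ringDefinable_atom₃ ringDefinable_natPairGraph (definableFun_proj_params _) (definableFun_proj_params _)
        (definableFun_proj_params _))))
  convert h using 1
  ext u
  simp only [mem_setOf_eq, Matrix.cons_val_zero, Matrix.cons_val_one, Matrix.cons_val]
  constructor
  · intro hu
    exact ⟨![((u 0).toNat : ℤ), ((u 1).toNat : ℤ)], rfl, rfl, Int.natCast_nonneg _, Int.natCast_nonneg _,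
      by simpa only [Matrix.cons_val_zero, Matrix.cons_val_one, Int.toNat_natCast] using hu⟩
  · rintro ⟨w, hw0, hw1, -, -, hu⟩
    rw [hw0, hw1, Int.toNat_natCast, Int.toNat_natCast] at hu
    exact hu

/-- `v ↦ encode (f v)` (Mathlib's coding of `ℤ`) is a ring-definable function for ring-definable `f`. [folklore] -/
theorem ringDefinableFun_encodeInt {f : (α → ℤ) → ℤ} (hf : (∅ : Set ℤ).DefinableFun Language.ring f) :
    (∅ : Set ℤ).DefinableFun Language.ring (fun v => ((@encode ℤ Primcodable.toEncodable (f v) : ℕ) : ℤ)) := by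
  refine definableFun_apply_params (f := fun z : ℤ => ((@encode ℤ Primcodable.toEncodable z : ℕ) : ℤ)) ?_ hf
  have h : (∅ : Set ℤ).Definable Language.ring
      {v : Fin 2 → ℤ | (0 ≤ v 0 ∧ v 1 = 2 * v 0) ∨ (v 0 < 0 ∧ v 1 = -2 * v 0 - 1)} :=
    definable_setOf_or_params
      (definable_setOf_and_params (ringDefinable_setOf_nonneg (definableFun_proj_params _))
        (definable_setOf_eq_params (definableFun_proj_params _)
          (ringDefinableFun_mul (ringDefinableFun_intCast 2) (definableFun_proj_params _))))
      (definable_setOf_and_params (ringDefinable_setOf_lt (definableFun_proj_params _) ringDefinableFun_zero)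
        (definable_setOf_eq_params (definableFun_proj_params _) (ringDefinableFun_sub
          (ringDefinableFun_mul (ringDefinableFun_intCast (-2)) (definableFun_proj_params _)) ringDefinableFun_one)))
  convert h using 1
  ext v; simp only [mem_setOf_eq, natCast_encode_int]; split_ifs with h0 <;> omega

/-- The list coding `v ↦ encode [v 0, …, v (k-1)]` of `ℤ^k` is a ring-definable function (induction on `k`:
`encode (a :: l) = Nat.pair (encode a) (encode l) + 1`). [folklore] -/
theorem ringDefinableFun_encodeListOfFn : ∀ k : ℕ, (∅ : Set ℤ).DefinableFun Language.ring
    (fun v : Fin k → ℤ => ((@encode (List ℤ) (@List.encodable ℤ Primcodable.toEncodable) (List.ofFn v) : ℕ) : ℤ))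
  | 0 => by simpa using (ringDefinableFun_zero (α := Fin 0))
  | k + 1 => by
      have ih := ringDefinableFun_encodeListOfFn k
      have h := ringDefinableFun_add (ringDefinableFun_natPair
        (ringDefinableFun_encodeInt (definableFun_proj_params (0 : Fin (k + 1))))
        (definableFun_reindex ih Fin.succ)) ringDefinableFun_one
      convert h using 1
      funext v
      rw [List.ofFn_succ, encode_list_cons]
      push_cast
      simp only [Int.toNat_natCast]

/-- **Mathlib's coding `encode : ℤ^k → ℕ` is a ring-definable function of `k`-tuples.** [folklore] -/
theorem ringDefinableFun_encodeFinArrow (k : ℕ) : (∅ : Set ℤ).DefinableFun Language.ring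
    (fun v : Fin k → ℤ => ((@encode (Fin k → ℤ) Primcodable.toEncodable v : ℕ) : ℤ)) := by
  simpa only [encode_finArrow_int] using ringDefinableFun_encodeListOfFn k

/-! ## Computable subsets of `ℤ^k` are ring-definable -/

/-- **Every computable subset of `ℤ^k` is `∅`-definable in the ring `ℤ`.**  If `p : (Fin k → ℤ) → Prop` has a recursive
decision procedure (`ComputablePred p`), then `{v | p v}` is ring-definable: the characteristic function is partial recursive on
codes (`Computable` unfolds to `Nat.Partrec`), its graph is definable by REPRESENTABILITY (`ringDefinable_graph_of_partrec`), and
`p v ↔ (encode v, 1) ∈ graph` with `encode` definable (`ringDefinableFun_encodeFinArrow`). [folklore] -/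
theorem ringDefinable_setOf_computablePred {k : ℕ} {p : (Fin k → ℤ) → Prop} (hp : ComputablePred p) :
    (∅ : Set ℤ).Definable Language.ring {v : Fin k → ℤ | p v} := by
  obtain ⟨inst, hc⟩ := hp
  have hN : Nat.Partrec _ := hc
  have hG := ringDefinable_graph_of_partrec hN
  have h := ringDefinable_atom₂ hG (ringDefinableFun_encodeFinArrow k) ringDefinableFun_one
  convert h using 1
  ext v
  simp only [mem_setOf_eq, Matrix.cons_val_zero, Matrix.cons_val_one, Int.toNat_natCast, Int.toNat_one,
    Encodable.encodek, Part.coe_some, Part.bind_some, PFun.lift, Part.map_some, Part.mem_some_iff]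
  by_cases hv : p v
  · simp [hv]
  · simp [hv]

/-- Set form: a subset `S ⊆ ℤ^k` with computable membership is `∅`-definable in the ring `ℤ`. [folklore] -/
theorem ringDefinable_of_computablePred_mem {k : ℕ} {S : Set (Fin k → ℤ)} (hS : ComputablePred (· ∈ S)) :
    (∅ : Set ℤ).Definable Language.ring S :=
  ringDefinable_setOf_computablePred hS

/-- Substitution: a ring-definable `k`-ary condition at `k` definable functions (a `DefinableMap`, e.g. built with
`definableMap_vecCons`) is ring-definable — with the quantifier lemmas this closes the ring-definable sets under the operations
generating the ARITHMETICAL HIERARCHY from the computable sets. [folklore] -/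
theorem ringDefinable_setOf_substitute {k : ℕ} {p : (Fin k → ℤ) → Prop}
    (hp : (∅ : Set ℤ).Definable Language.ring {u : Fin k → ℤ | p u}) {F : (α → ℤ) → Fin k → ℤ}
    (hF : (∅ : Set ℤ).DefinableMap Language.ring F) :
    (∅ : Set ℤ).Definable Language.ring {v : α → ℤ | p (F v)} :=
  hp.preimage_map hF

/-! ## Unary forms over `ℕ` -/

/-- A computable predicate on `ℕ` defines an `∅`-definable subset `{n : p n} ⊆ ℤ`. [folklore] -/
theorem ringDefinable_setOf_computablePred_nat {p : ℕ → Prop} (hp : ComputablePred p) :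
    (∅ : Set ℤ).Definable Language.ring {v : Fin 1 → ℤ | ∃ n : ℕ, v 0 = n ∧ p n} := by
  obtain ⟨inst, hc⟩ := hp
  have hN : Nat.Partrec _ := hc
  have hG := ringDefinable_graph_of_partrec hN
  have h := ringDefinable_atom₂ hG (definableFun_proj_params (0 : Fin 1)) ringDefinableFun_one
  convert h using 1
  ext v
  simp only [mem_setOf_eq, Matrix.cons_val_zero, Matrix.cons_val_one, Int.toNat_one, decode_nat,
    Part.coe_some, Part.bind_some, PFun.lift, Part.map_some, Part.mem_some_iff]
  constructor
  · rintro ⟨n, hn, hpn⟩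
    rw [hn]; simp [hpn]
  · rintro ⟨h0, -, h1⟩
    refine ⟨(v 0).toNat, (Int.toNat_of_nonneg h0).symm, ?_⟩
    by_contra hpn
    simp [hpn] at h1

/-- The graph of a total computable function `ℕ → ℕ` is `∅`-definable in the ring `ℤ`. [folklore] -/
theorem ringDefinable_graph_of_computable {f : ℕ → ℕ} (hf : Computable f) :
    (∅ : Set ℤ).Definable Language.ring {v : Fin 2 → ℤ | ∃ n : ℕ, v 0 = n ∧ v 1 = f n} := by
  have hN : Nat.Partrec (f : ℕ →. ℕ) := Partrec.nat_iff.1 hf.partrec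
  convert ringDefinable_natGraph_of_partrec hN using 1
  ext v
  simp only [mem_setOf_eq, PFun.coe_val, Part.mem_some_iff]
  constructor
  · rintro ⟨n, hn, hfn⟩; exact ⟨n, f n, hn, hfn, rfl⟩
  · rintro ⟨a, b, ha, hb, rfl⟩; exact ⟨a, ha, hb⟩

end RingZ

/-! ## Registered form -/

/-- Registered helper stub `ringDefinable_of_computablePred_std` of crux stmt-Schanuel-0969 (line kernel-arithmetic-selection,
S8): **every computable subset of `ℤ^k` is `∅`-definable in the ring `ℤ`** (Mathlib's standard structure
`FirstOrder.Ring.compatibleRingOfRing ℤ`) — Gödel–Kleene representability; with the quantifier closure lemmas every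
arithmetical subset of `ℤ^k` is ring-definable, hence (`stub_arithmeticTransfer`) `∅`-definable in `ℂ_exp`. [folklore] -/
theorem ringDefinable_of_computablePred_std : ∀ (k : ℕ) (S : Set (Fin k → ℤ)), ComputablePred (fun v : Fin k → ℤ => v ∈ S) → (letI := FirstOrder.Ring.compatibleRingOfRing ℤ; (∅ : Set ℤ).Definable FirstOrder.Language.ring S) := by
  intro k S hS
  letI := FirstOrder.Ring.compatibleRingOfRing ℤ
  exact ringDefinable_of_computablePred_mem hS

end Summit.Schanuel.Schanuel.Cruxes.MinimalCounterexampleInAcl.KernelArithmeticSelection
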